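import Literature.Probability.Percolation.FivePointContour
import Literature.Probability.Percolation.FivePointBoundarySite
import Literature.Probability.Percolation.FivePointNormalisation
import HarnessLib

/-!
# The discrete boundary-value problem of the five-point sparse observables, in one statement

Topic `Literature/Probability/Percolation`; five-point lineage, PACKAGING file (no new combinatorics). For a five-marked discrete domain
`D : TriMarkedDomain 5` (Bollobás–Riordan's marked discrete domains of the triangular lattice with five marks) the lane's tree theorems
about the five-point observables `H_r(e) = midEdgeProb D r c x x'`, `H_{r,M}(e) = patternProb D r c m x x'` and the SPARSE FIVE-POINT
OBSERVABLE `F_j(e) = sparseObs D j c x x' = H_{j,A}(e) − τ² H_{j+1,B}(e) − τ H_{j−1,B}(e)` (`τ = e^{2πi/3}`) are collected into ONE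
proposition `FivePoint.DiscreteBVP D`, proved for EVERY `D` (`FivePoint.discreteBVP_holds`) — the single declaration a write-up cites for
«the five sparse observables solve the following discrete Riemann–Hilbert-type boundary-value problem on every five-marked domain»:

* (N)   `normalisation` — `Σ_{r : Fin 5} H_r(e) = 1` at every edge of `H_G` (`Bdry.sum_midEdgeProb_eq_one`; interior edition
        `N5.hexFivePointNormalisation_holds`), and `sum_sparseObs` — `Σ_j F_j(e) = 1` (`Contour.sum_sparseObs_eq_one`);
* (H∂)  `holomorphy` — `Σ_{k : Fin 3} τ^k F_j(v, ccwNbr v k) = 0` at every face `v` of `𝕋` with at least two sites in `G`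
        (`BdryH.hexFivePointHolomorphyBdry_holds`; interior faces `holomorphy_interior` = `N5.hexFivePointHolomorphy_holds`);
* (∮)   `contour`, `global_contour` — the signed `τ`-weighted sums over the edges leaving any finite set of valence-3 faces, and over all
        of them, vanish (`Contour.fivePointContourAllSides_eq_zero`, `Contour.fivePointGlobalContour_eq_zero`);
* `symm` — `F_j` is a function of the unordered edge (`Contour.sparseObs_comm`);
* (T-SITE) `site_law` (`Bdry.boundarySiteLaw_holds`), (T-CORNER) `corner_law` (`Bdry.cornerToggleLaw_holds`);
* (B∂)/(N∂) `support`, `boundary_normalisation`, `simplex` (`Bdry.boundarySupport_holds`, `boundaryNormalisation_holds`,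
        `boundary_simplex`): on a boundary edge of the arc `A_i` only the classes `(i,A), (i,B), (i+1,A), (i+1,B), (i+3,A)` carry mass, and
        their five probabilities sum to one;
* `arc_values` — hence the boundary values of the sparse observables on `A_i` (`Bdry.sparseObs_arc_*`): `F_{i+2} = −τ·H_{i+1,B}`,
        `F_{i+3} = H_{i+3,A}`, `F_{i+4} = −τ²·H_{i,B}` (three rays through `0`), `F_i = H_{i,A} − τ² H_{i+1,B}`,
        `F_{i+1} = H_{i+1,A} − τ H_{i,B}`.

The explicit crossing-probability VALUES of the five surviving classes (the six-change dictionary `FivePointSixChange.lean`,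
`Six.patternProb_*`) are not imported here: they identify the boundary data, the problem above only constrains its directions.

## References
* M. Khristoforov, S. Smirnov, *Percolation and O(1) loop model*, arXiv:2111.15612 (2021): §1.2 Lemma 2 and §2 Definition 3 /
  Lemma 4 / Corollary 5 / eq. (4) (arXiv v1 pp. 3–5) — the three-disorder statements of which the items above are the lane's
  five-disorder analogues (the analogues themselves are not in print: THEOREM-SHEET-fivepoint.md §2–§3 of the lane).
* B. Bollobás, O. Riordan, *Percolation*, CUP (2006), Ch. 7 §7.2.2 (pp. 191–195): marked discrete domains.

## Mathlib / tree
Tree only: `FiveMarkedLoops.lean` (`midEdgeProb`, `patternProb`, `sparseObs`), `FivePointBoundaryValues.lean` (`Bdry.sum_midEdgeProb_eq_one`,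
`Bdry.IsBoundaryEdge`, `Bdry.AllowedClass`, `Bdry.BoundarySupport`, `Bdry.BoundaryNormalisation`, `Bdry.sparseObs_arc_*`),
`FivePointCornerToggle.lean` (`Bdry.IsDualEdge`, `Bdry.CornerToggleLaw`, `Bdry.boundary_simplex`), `FivePointBoundarySite.lean`
(`Bdry.BoundarySiteLaw`), `FivePointHolomorphyBdry.lean` (`BdryH.AllSides`, `BdryH.hexFivePointHolomorphyBdry_holds`),
`FivePointHolomorphy.lean` (`N5.hexFivePointHolomorphy_holds`), `FivePointNormalisation.lean` (`N5.hexFivePointNormalisation_holds`),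
`FivePointContour.lean` (`Contour.sgn`, `Contour.allSidesFaces`, `Contour.sum_sparseObs_eq_one`, `Contour.fivePointContourAllSides_eq_zero`,
`Contour.fivePointGlobalContour_eq_zero`, `Contour.sparseObs_comm`).
-/

open Finset

namespace Literature.Probability.Percolation.FivePoint

open Literature.Probability.Percolation Literature.Probability.LatticeModels
open TriMarkedDomain
open N5 Bdry BdryH Contour

section DiscreteBVP

variable (D : TriMarkedDomain 5)

/-- **The discrete boundary-value problem of the five-point sparse observables** on a five-marked discrete domain, as ONE proposition:
normalisation (N) and `Σ_j F_j = 1` at every `H_G`-edge; discrete holomorphicity (H∂) at every face with two sites in `G` (and its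
interior case); the contour identities; symmetry in the edge; the boundary laws (T-SITE), (T-CORNER); the boundary support (B∂) with the
boundary normalisation (N∂) and the boundary simplex; and the resulting boundary values of `F_j` on each arc (three on rays through `0`,
two in explicit two-term form). [cite: KhristoforovSmirnov2021, §2 Definition 3, Lemma 4, Corollary 5, eq. (4) (arXiv v1 pp. 4–5), five-disorder analogue] -/
structure DiscreteBVP (D : TriMarkedDomain 5) : Prop where
  /-- (N) at every edge of `H_G`: `Σ_r H_r(e) = 1`. -/
  normalisation : ∀ (c : Bool) (x x' : HexVertex) (g o : Site 2), hexGraph.Adj x x' → faceEdge x x' = {g, o} → g ∈ D.verts →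
    ∑ r : Fin 5, midEdgeProb D r c x x' = 1
  /-- (N), interior edition (both sites of the bond and all sites of `x` in `G`). -/
  normalisation_interior : ∀ (c : Bool) (x x' : HexVertex), hexFaceVertices x ⊆ D.verts → hexGraph.Adj x x' →
    faceEdge x x' ⊆ D.verts → ∑ r : Fin 5, midEdgeProb D r c x x' = 1
  /-- `Σ_j F_j(e) = 1` at every edge of `H_G`. -/
  sum_sparseObs : ∀ (x x' : HexVertex), hexGraph.Adj x x' → (∃ g ∈ faceEdge x x', g ∈ D.verts) → ∀ c : Bool,
    ∑ j : Fin 5, sparseObs D j c x x' = 1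
  /-- `F_j` is a function of the unordered edge. -/
  symm : ∀ (j : Fin 5) (c : Bool) (x x' : HexVertex), sparseObs D j c x x' = sparseObs D j c x' x
  /-- (H∂) discrete holomorphicity at every face with at least two sites in `G` (anticlockwise neighbours `ccwNbr`). -/
  holomorphy : ∀ (c : Bool) (j : Fin 5) (v : HexVertex), 2 ≤ #((hexFaceVertices v).filter (· ∈ D.verts)) →
    ∑ k : Fin 3, tau ^ (k : ℕ) * sparseObs D j c v (ccwNbr v k) = 0
  /-- (H) the interior case. -/
  holomorphy_interior : ∀ (c : Bool) (j : Fin 5) (v : HexVertex), hexFaceVertices v ⊆ D.verts →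
    ∑ k : Fin 3, tau ^ (k : ℕ) * sparseObs D j c v (ccwNbr v k) = 0
  /-- (∮) the contour identity around every finite set of faces with three `H_G`-sides. -/
  contour : ∀ (c : Bool) (j : Fin 5) (Λ : Finset HexVertex), (∀ v ∈ Λ, BdryH.AllSides D v) →
    ∑ v ∈ Λ, ∑ k ∈ (Finset.univ : Finset (Fin 3)).filter (fun k => ccwNbr v k ∉ Λ),
      Contour.sgn v * tau ^ (k : ℕ) * sparseObs D j c v (ccwNbr v k) = 0
  /-- (∮) the global contour: all valence-3 vertices of `H_G` at once. -/
  global_contour : ∀ (c : Bool) (j : Fin 5),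
    ∑ v ∈ Contour.allSidesFaces D, ∑ k ∈ (Finset.univ : Finset (Fin 3)).filter (fun k => ccwNbr v k ∉ Contour.allSidesFaces D),
      Contour.sgn v * tau ^ (k : ℕ) * sparseObs D j c v (ccwNbr v k) = 0
  /-- (T-SITE) the boundary trace is a function of the boundary hexagon. -/
  site_law : Bdry.BoundarySiteLaw D
  /-- (T-CORNER) the toggle law across each corner face. -/
  corner_law : Bdry.CornerToggleLaw D
  /-- (B∂) only the five allowed classes carry mass on a boundary edge of `A_i`. -/
  support : Bdry.BoundarySupport D
  /-- (N∂) the five mid-edge probabilities sum to one on boundary edges. -/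
  boundary_normalisation : Bdry.BoundaryNormalisation D
  /-- the boundary simplex: `H_{i,A} + H_{i,B} + H_{i+1,A} + H_{i+1,B} + H_{i+3,A} = 1` on `A_i`. -/
  simplex : ∀ (i : Fin 5) (x x' : HexVertex), Bdry.IsBoundaryEdge D i x x' → ∀ c : Bool,
    patternProb D i c false x x' + patternProb D i c true x x' + patternProb D (i + 1) c false x x' +
      patternProb D (i + 1) c true x x' + patternProb D (i + 3) c false x x' = 1
  /-- the boundary values of the sparse observables on `A_i`. -/
  arc_values : ∀ (i : Fin 5) (x x' : HexVertex), Bdry.IsBoundaryEdge D i x x' → ∀ c : Bool,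
    sparseObs D (i + 2) c x x' = -(tau * (patternProb D (i + 1) c true x x' : ℂ)) ∧
    sparseObs D (i + 3) c x x' = (patternProb D (i + 3) c false x x' : ℂ) ∧
    sparseObs D (i + 4) c x x' = -(tau ^ 2 * (patternProb D i c true x x' : ℂ)) ∧
    sparseObs D i c x x' = (patternProb D i c false x x' : ℂ) - tau ^ 2 * (patternProb D (i + 1) c true x x' : ℂ) ∧
    sparseObs D (i + 1) c x x' = (patternProb D (i + 1) c false x x' : ℂ) - tau * (patternProb D i c true x x' : ℂ)

/-- ★ **Every five-marked discrete domain satisfies the discrete boundary-value problem** `FivePoint.DiscreteBVP` — collected from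
the tree theorems listed in the header. [cite: KhristoforovSmirnov2021, §2 Definition 3, Lemma 4, Corollary 5, eq. (4) (arXiv v1 pp. 4–5), five-disorder analogue] -/
theorem discreteBVP_holds : DiscreteBVP D where
  normalisation := fun c _ _ _ _ hadj he hg => Bdry.sum_midEdgeProb_eq_one D hadj he hg c
  normalisation_interior := fun c x x' hx hadj he => N5.hexFivePointNormalisation_holds D c x x' hx hadj he
  sum_sparseObs := fun _ _ hadj hG c => Contour.sum_sparseObs_eq_one D hadj hG c
  symm := Contour.sparseObs_comm D
  holomorphy := BdryH.hexFivePointHolomorphyBdry_holds D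
  holomorphy_interior := N5.hexFivePointHolomorphy_holds D
  contour := Contour.fivePointContourAllSides_eq_zero D
  global_contour := Contour.fivePointGlobalContour_eq_zero D
  site_law := Bdry.boundarySiteLaw_holds D
  corner_law := Bdry.cornerToggleLaw_holds D
  support := Bdry.boundarySupport_holds D
  boundary_normalisation := Bdry.boundaryNormalisation_holds D
  simplex := fun _ _ _ he c => Bdry.boundary_simplex D he c
  arc_values := fun _ _ _ he c =>
    ⟨Bdry.sparseObs_arc_add_two he c, Bdry.sparseObs_arc_add_three he c, Bdry.sparseObs_arc_add_four he c,
      Bdry.sparseObs_arc_self he c, Bdry.sparseObs_arc_add_one he c⟩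

end DiscreteBVP

end Literature.Probability.Percolation.FivePoint
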